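import Summits.CriticalPhenomena.CardyFormulaZ2.Theorems.CardyIKTransportIKLinearTransportScreening2
import Summits.CriticalPhenomena.CardyFormulaZ2.Theorems.CardyIKTransportIKLinearTransportScreeningArrayExact2
import Summits.CriticalPhenomena.CardyFormulaZ2.Theorems.CardyIKTransportIKLinearTransportRatioMixEndgame
import Summits.CriticalPhenomena.CardyFormulaZ2.Theorems.CardyIKTransportIKLinearTransportTransportDefs

/-!
# `ratioMix_of_masterMul` (crux stmt-CriticalPhenomena-5076 `CardyIKTransport.IKLinearTransport`, line
# `pinned-diagram-exchange`) — sub-goal 3/3 of the skeleton stub `stub_RatioMix`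

Theorem-only file (`--supports stmt-CriticalPhenomena-5076`; proves the registered sub-goal
`ratioMix_of_masterMul` BY NAME and signature). DENSITY-FORM far-field ratio mixing of the column-mixed gauge
colour field at ALL aspect ratios `w, h ≤ k n`:
`|ν_S(E ∩ L) − ν_S(E) ν_S(L)| ≤ η ν_S(E) ν_S(L)` (`RatioMixBound η S n a b w h E L`) for `n ≥ N(k, η)`,
DERIVED from two array-level hypotheses (the antecedents of the registered implication, proved in sibling
files): `h₁`, the multiplicative offset lemma on finite arrays (explicit factor `((1 + θ^n)/(1 − θ^n))^{w+h}`),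
and `h₂`, the density-form master screening inequality for synthetic statistics with a free factor `Tf`.

PROOF: (1) `ratioMix_error_small` — for `θ = θIK < 1/8`, `x = θ^n`, the factor
`T = ((1+x)/(1−x))^{w+h} ≤ (1 + 3x)^{w+h} ≤ exp (3 (w+h) x) ≤ 1 + 6 (w + h) x` (once `3 (w+h) x ≤ 1`), and
`(w + h) x ≤ 2 k · n θ^n → 0` (`tendsto_self_mul_const_pow_of_lt_one`); together with `sigmaExact_small`
(aspect bound `K = k + 2`) this makes `2 σ T + (T − 1) ≤ η` and `σ ≤ 1` from some `N ≥ 1` on.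
(2) The event level is the landed `stub_Screening` argument verbatim (…Screening2.lean §5.6): pull back along
the `μIK`-preserving anchored shear (`screenShear_measurePreserving`), rewrite the far event / box event as
synthetic indicators (`obsShear_agree_far/_box`, `farObs_projEnv`, `boxObs_projEnv`, `boxObs_offset`), and
apply `h₂` with `Tf = T`, the offset hypothesis of `h₂` being `h₁` at `p = pcol S (a − n) (w + 2n − 1)`
(`pcol_props`).
-/

noncomputable section

/-! ### §1 The error analysis -/

namespace Summit.CriticalPhenomena.CardyFormulaZ2.Theorems.IKLinearTransport.PinnedDiagramExchange.ScreeningAssembly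

open ScreeningArray

/-- ERROR SMALLNESS for the density form: for every aspect bound `k` and `η > 0`, from some `N ≥ 1` on,
`σ_exact ≤ 1` and `2 σ_exact T + (T − 1) ≤ η` for all `w, h ≤ k n`, where
`T = ((1 + θ^n)/(1 − θ^n))^{w+h}`, `θ = θIK`, array `(w+2n−1) × (h+2n−1)`. [folklore] -/
theorem ratioMix_error_small :
    ∀ (k : ℕ) (η : ℝ), 0 < η → ∃ N : ℕ, 1 ≤ N ∧ ∀ n : ℕ, N ≤ n → ∀ w h : ℕ, w ≤ k * n → h ≤ k * n →
      sigmaExact (w + 2 * n - 1) (h + 2 * n - 1) n θIK ≤ 1 ∧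
      2 * sigmaExact (w + 2 * n - 1) (h + 2 * n - 1) n θIK * ((1 + θIK ^ n) / (1 - θIK ^ n)) ^ (w + h) +
        (((1 + θIK ^ n) / (1 - θIK ^ n)) ^ (w + h) - 1) ≤ η := by
  intro k η hη
  obtain ⟨hθ0, hθ1, hθ8⟩ := θIK_bounds
  -- the array error `σ_exact ≤ min η 1 / 8` from `N₁` on (aspect bound `K = k + 2`)
  have hε8 : (0 : ℝ) < min η 1 / 8 := by positivity
  obtain ⟨N₁, hN₁1, hN₁⟩ := sigmaExact_small θIK hθ0 hθ8.le (k + 2) (min η 1 / 8) hε8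
  -- the rate `n θ^n → 0`
  have hu : Filter.Tendsto (fun n : ℕ => (n : ℝ) * θIK ^ n) Filter.atTop (nhds 0) :=
    tendsto_self_mul_const_pow_of_lt_one hθ0 (by linarith)
  have hδ : (0 : ℝ) < min η 1 / (48 * k + 48) := by positivity
  obtain ⟨N₀, hN₀⟩ := Filter.eventually_atTop.1 (hu.eventually_lt_const hδ)
  refine ⟨max N₀ N₁, le_trans hN₁1 (le_max_right _ _), fun n hn w h hw hh => ?_⟩
  have hnN₁ : N₁ ≤ n := le_trans (le_max_right _ _) hn
  have hn1 : 1 ≤ n := le_trans hN₁1 hnN₁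
  have hun : (n : ℝ) * θIK ^ n < min η 1 / (48 * k + 48) := hN₀ n (le_trans (le_max_left _ _) hn)
  have hmin1 : min η 1 ≤ 1 := min_le_right _ _
  have hminη : min η 1 ≤ η := min_le_left _ _
  have hKn : (k + 2) * n = k * n + 2 * n := by ring
  have hσ : sigmaExact (w + 2 * n - 1) (h + 2 * n - 1) n θIK ≤ min η 1 / 8 :=
    hN₁ n hnN₁ _ _ (by omega) (by omega) (by omega) (by omega)
  have hσ0 : 0 ≤ sigmaExact (w + 2 * n - 1) (h + 2 * n - 1) n θIK :=
    sigmaExact_nonneg _ _ n hn1 (by omega) (by omega) θIK hθ0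
  -- the factor `T = ((1 + x)/(1 - x))^(w + h)`, `x = θ^n ≤ θ < 1/8`
  set x := θIK ^ n with hx
  have hx0 : 0 ≤ x := pow_nonneg hθ0 n
  have hxθ : x ≤ θIK := by
    calc x = θIK ^ n := hx
      _ ≤ θIK ^ 1 := pow_le_pow_of_le_one hθ0 hθ1 hn1
      _ = θIK := pow_one _
  have hx8 : x < 1 / 8 := lt_of_le_of_lt hxθ hθ8
  have hq : (1 + x) / (1 - x) ≤ 1 + 3 * x := by
    rw [div_le_iff₀ (by linarith)]
    nlinarith
  have hq1 : 1 ≤ (1 + x) / (1 - x) := by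
    rw [one_le_div (by linarith)]
    linarith
  have hq0 : 0 ≤ (1 + x) / (1 - x) := le_trans zero_le_one hq1
  set T := ((1 + x) / (1 - x)) ^ (w + h) with hT
  -- the exponent `y = 3 (w + h) x ≤ 6 k · n x ≤ min η 1 / 8`
  have hw' : (w : ℝ) ≤ k * n := by exact_mod_cast hw
  have hh' : (h : ℝ) ≤ k * n := by exact_mod_cast hh
  have hk0 : (0 : ℝ) ≤ k := Nat.cast_nonneg k
  have hnx0 : 0 ≤ (n : ℝ) * x := by positivity
  have hy0 : 0 ≤ ((w + h : ℕ) : ℝ) * (3 * x) := by positivity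
  have hwh : ((w + h : ℕ) : ℝ) ≤ 2 * k * n := by push_cast; linarith
  have hun' : (n : ℝ) * x * (48 * k + 48) < min η 1 :=
    (lt_div_iff₀ (show (0 : ℝ) < 48 * k + 48 by positivity)).mp hun
  have hy : ((w + h : ℕ) : ℝ) * (3 * x) ≤ min η 1 / 8 := by
    calc ((w + h : ℕ) : ℝ) * (3 * x) ≤ (2 * k * n) * (3 * x) := mul_le_mul_of_nonneg_right hwh (by positivity)
      _ = 6 * k * ((n : ℝ) * x) := by ring
      _ ≤ min η 1 / 8 := by nlinarith
  have hy1 : ((w + h : ℕ) : ℝ) * (3 * x) ≤ 1 := by linarith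
  -- `T ≤ exp y ≤ 1 + 2 y`
  have hTexp : T ≤ Real.exp (((w + h : ℕ) : ℝ) * (3 * x)) := by
    calc T = ((1 + x) / (1 - x)) ^ (w + h) := hT
      _ ≤ (1 + 3 * x) ^ (w + h) := pow_le_pow_left₀ hq0 hq _
      _ ≤ (Real.exp (3 * x)) ^ (w + h) :=
          pow_le_pow_left₀ (by positivity) (by linarith [Real.add_one_le_exp (3 * x)]) _
      _ = Real.exp (((w + h : ℕ) : ℝ) * (3 * x)) := (Real.exp_nat_mul (3 * x) _).symm
  have hexp : Real.exp (((w + h : ℕ) : ℝ) * (3 * x)) - 1 ≤ 2 * (((w + h : ℕ) : ℝ) * (3 * x)) := by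
    have habs : |((w + h : ℕ) : ℝ) * (3 * x)| ≤ 1 := by rw [abs_of_nonneg hy0]; exact hy1
    have := Real.abs_exp_sub_one_le habs
    rw [abs_of_nonneg hy0] at this
    exact le_trans (le_abs_self _) this
  have hTη : T - 1 ≤ min η 1 / 4 := by linarith
  have hT2 : T ≤ 2 := by linarith
  have hσT : sigmaExact (w + 2 * n - 1) (h + 2 * n - 1) n θIK * T ≤
      sigmaExact (w + 2 * n - 1) (h + 2 * n - 1) n θIK * 2 := mul_le_mul_of_nonneg_left hT2 hσ0
  constructor
  · linarith
  · linarith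

end Summit.CriticalPhenomena.CardyFormulaZ2.Theorems.IKLinearTransport.PinnedDiagramExchange.ScreeningAssembly

/-! ### §2 The registered sub-goal -/

namespace Summit.CriticalPhenomena.CardyFormulaZ2.Theorems.IKLinearTransport.PinnedDiagramExchange

open scoped Classical symmDiff BigOperators
open MeasureTheory ProbabilityTheory Set
open Literature.Probability.Percolation Literature.Probability.LatticeModels
open ScreeningAssembly ScreeningGauge ScreeningArray

/-- REGISTERED SUB-GOAL `ratioMix_of_masterMul` (sub-goal 3/3 of `stub_RatioMix`) — DENSITY-FORM FAR-FIELD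
RATIO MIXING AT ALL ASPECT RATIOS from the two array-level sub-goals: if (h₁) the box statistics of a biased
array change at most by the factor `((1 + θ^n)/(1 − θ^n))^{w+h}` under additive offsets and (h₂) the
density-form master screening inequality holds for synthetic statistics with any admissible factor `Tf`,
then for every aspect bound `k` and `η > 0` there is `N` such that for `n ≥ N`, every pattern `S`, every
`w × h` box with `w, h ≤ k n`, every measurable `E` determined at sup-distance `≥ n` from the box and every
measurable `L` determined by the box, `|ν_S(E ∩ L) − ν_S(E) ν_S(L)| ≤ η ν_S(E) ν_S(L)`. PROOF: the event
level of `stub_Screening` verbatim (pull back along `screenShear`, synthetic indicators), `h₂` with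
`Tf = ((1 + θ^n)/(1 − θ^n))^{w+h}` and the offset hypothesis supplied by `h₁` at `p = pcol S (a − n) (w+2n−1)`,
and `ratioMix_error_small`. [folklore] -/
theorem ratioMix_of_masterMul :
    (∀ (n w h : ℕ), 1 ≤ n → ∀ (p : Fin (w + 2 * n - 1) → ℝ) (θ : ℝ),
      (∀ c, 0 ≤ p c ∧ p c ≤ 1) → 0 ≤ θ → θ < 1 → (∀ c, |1 - 2 * p c| ≤ θ) →
      ∀ (G : (Fin w × Fin h → Bool) → ℝ), (∀ t, 0 ≤ G t) → ∀ (A : Fin w → Bool) (B : Fin h → Bool),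
      arrSum (k := h + 2 * n - 1) p
          (fun q => G (fun ij => xor (boxData n w h q ij) (xor (A ij.1) (B ij.2)))) ≤
        ((1 + θ ^ n) / (1 - θ ^ n)) ^ (w + h) * arrSum (k := h + 2 * n - 1) p (fun q => G (boxData n w h q))) →
    (∀ (S : Set ℤ) (a b : ℤ) (w h n : ℕ), 1 ≤ n →
      sigmaExact (w + 2 * n - 1) (h + 2 * n - 1) n θIK ≤ 1 →
      ∀ (Tf : ℝ), 1 ≤ Tf →
      (∀ (G : (Fin w × Fin h → Bool) → ℝ), (∀ t, 0 ≤ G t) → ∀ (A : Fin w → Bool) (B : Fin h → Bool),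
        arrSum (k := h + 2 * n - 1) (pcol S (a - n) (w + 2 * n - 1))
            (fun q => G (fun ij => xor (boxData n w h q ij) (xor (A ij.1) (B ij.2)))) ≤
          Tf * arrSum (k := h + 2 * n - 1) (pcol S (a - n) (w + 2 * n - 1)) (fun q => G (boxData n w h q))) →
      ∀ (envE : Ω → (Fin (w + 2 * n - 1) → Bool) × (Fin (h + 2 * n - 1) → Bool) → ℝ)
        (bInd : Ω → (Fin w × Fin h → Bool) → (Fin w × Fin h → Bool) → ℝ),
      (∀ kk, Measurable fun x => envE x kk) → (∀ x kk, 0 ≤ envE x kk ∧ envE x kk ≤ 1) →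
      (∀ t cc, Measurable fun x => bInd x t cc) → (∀ x t cc, 0 ≤ bInd x t cc ∧ bInd x t cc ≤ 1) →
      (∀ x x' : Ω, ∃ (A : Fin w → Bool) (B : Fin h → Bool), ∀ t cc,
        bInd x' t cc = bInd x (fun ij => xor (t ij) (xor (A ij.1) (B ij.2))) cc) →
      |(∫ ω, envE (projEnv a b w h n ω) (parities (Qarr S (a - n) (b - n) (w + 2 * n - 1) (h + 2 * n - 1) ω)) *
            bInd (projEnv a b w h n ω) (boxData n w h (Qarr S (a - n) (b - n) (w + 2 * n - 1) (h + 2 * n - 1) ω))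
              (Cbox a b w h ω) ∂μIK) -
          (∫ ω, envE (projEnv a b w h n ω)
              (parities (Qarr S (a - n) (b - n) (w + 2 * n - 1) (h + 2 * n - 1) ω)) ∂μIK) *
            ∫ ω, bInd (projEnv a b w h n ω)
              (boxData n w h (Qarr S (a - n) (b - n) (w + 2 * n - 1) (h + 2 * n - 1) ω)) (Cbox a b w h ω) ∂μIK| ≤
        (2 * sigmaExact (w + 2 * n - 1) (h + 2 * n - 1) n θIK * Tf + (Tf - 1)) *
          ((∫ ω, envE (projEnv a b w h n ω)
              (parities (Qarr S (a - n) (b - n) (w + 2 * n - 1) (h + 2 * n - 1) ω)) ∂μIK) *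
            ∫ ω, bInd (projEnv a b w h n ω)
              (boxData n w h (Qarr S (a - n) (b - n) (w + 2 * n - 1) (h + 2 * n - 1) ω)) (Cbox a b w h ω) ∂μIK)) →
    ∀ (k : ℕ) (η : ℝ), 0 < η → ∃ N : ℕ, ∀ (S : Set ℤ) (n : ℕ), N ≤ n → ∀ (a b : ℤ) (w h : ℕ),
      w ≤ k * n → h ≤ k * n → ∀ E L : Set Obs, MeasurableSet E → MeasurableSet L →
      RatioMixBound η S n a b w h E L := by
  intro h₁ h₂ k η hη
  obtain ⟨N, hN1, hN⟩ := ratioMix_error_small k η hη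
  refine ⟨N, fun S n hn a b w h hw hh E L hE hL => ?_⟩
  unfold RatioMixBound
  intro hEfar hLbox
  have hn1 : 1 ≤ n := le_trans hN1 hn
  obtain ⟨hσ1, hε'⟩ := hN n hn w h hw hh
  obtain ⟨hθ0, hθ1, hθ8⟩ := θIK_bounds
  have hθlt1 : θIK < 1 := by linarith
  obtain ⟨hp, hpθ, -, -⟩ := pcol_props S (a - n) (w + 2 * n - 1)
  have hm : ((w + 2 * n - 1 : ℕ) : ℤ) = w + 2 * n - 1 := by omega
  have hk : ((h + 2 * n - 1 : ℕ) : ℤ) = h + 2 * n - 1 := by omega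
  have hΨ := screenShear_measurePreserving S (a - n) (a + w + n) (b - n) (b + h + n)
  -- (F-E), (F-L): after the shear the observables factor through the synthetic ones
  have hFE : ∀ ω : Ω, obs S (screenShear S (a - n) (a + w + n) (b - n) (b + h + n) ω) ∈ E ↔
      farObs S (a - n) (a + w + n) (b - n) (b + h + n) (w + 2 * n - 1) (h + 2 * n - 1) (projEnv a b w h n ω)
        (parities (Qarr S (a - n) (b - n) (w + 2 * n - 1) (h + 2 * n - 1) ω)) ∈ E := by
    intro ω
    refine hEfar _ _ fun v hv => ?_
    have hvb : v ∉ boxCells a b w h := by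
      simp only [farFrom, boxCells, Set.mem_setOf_eq] at hv ⊢
      omega
    have h1 := obsShear_agree_far S a b w h n (w + 2 * n - 1) (h + 2 * n - 1) ω v hm hk hv
    have h2 := farObs_projEnv S a b w h n (w + 2 * n - 1) (h + 2 * n - 1) ω
      (parities (Qarr S (a - n) (b - n) (w + 2 * n - 1) (h + 2 * n - 1) ω)) v hvb
    exact ⟨h1.1.trans h2.1.symm, h1.2.trans h2.2.symm⟩
  have hFL : ∀ ω : Ω, obs S (screenShear S (a - n) (a + w + n) (b - n) (b + h + n) ω) ∈ L ↔
      boxObs S (a - n) (a + w + n) (b - n) (b + h + n) a b w h (projEnv a b w h n ω)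
        (boxData n w h (Qarr S (a - n) (b - n) (w + 2 * n - 1) (h + 2 * n - 1) ω)) (Cbox a b w h ω) ∈ L := by
    intro ω
    rw [boxObs_projEnv]
    exact hLbox _ _ fun v hv => obsShear_agree_box S a b w h n (w + 2 * n - 1) (h + 2 * n - 1) ω v hm hk hv
  -- pull back to `Ω` along the measure-preserving shear
  have hpull : ∀ A : Set Obs, MeasurableSet A → (νmix S).real A =
      ∫ ω, (screenShear S (a - n) (a + w + n) (b - n) (b + h + n) ⁻¹' (obs S ⁻¹' A)).indicator
        (1 : Ω → ℝ) ω ∂μIK := by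
    intro A hA
    rw [integral_indicator_one (hΨ.measurable (CouplingToLimits.measurable_obs S hA)), nuMix_real_eq S hA,
      hΨ.measureReal_preimage (CouplingToLimits.measurable_obs S hA).nullMeasurableSet]
  -- the synthetic indicators and their properties
  have henvm : ∀ kk, Measurable fun x : Ω =>
      if farObs S (a - n) (a + w + n) (b - n) (b + h + n) (w + 2 * n - 1) (h + 2 * n - 1) x kk ∈ E
        then (1 : ℝ) else 0 := fun kk =>
    Measurable.ite (measurable_farObs S (a - n) (a + w + n) (b - n) (b + h + n) (w + 2 * n - 1)
      (h + 2 * n - 1) kk hE) measurable_const measurable_const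
  have henv01 : ∀ (x : Ω) kk,
      0 ≤ (if farObs S (a - n) (a + w + n) (b - n) (b + h + n) (w + 2 * n - 1) (h + 2 * n - 1) x kk ∈ E
        then (1 : ℝ) else 0) ∧
      (if farObs S (a - n) (a + w + n) (b - n) (b + h + n) (w + 2 * n - 1) (h + 2 * n - 1) x kk ∈ E
        then (1 : ℝ) else 0) ≤ 1 := fun x kk => by
    split_ifs <;> norm_num
  have hbm : ∀ t cc, Measurable fun x : Ω =>
      if boxObs S (a - n) (a + w + n) (b - n) (b + h + n) a b w h x t cc ∈ L then (1 : ℝ) else 0 :=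
    fun t cc => Measurable.ite (measurable_boxObs S (a - n) (a + w + n) (b - n) (b + h + n) a b w h t cc hL)
      measurable_const measurable_const
  have hb01 : ∀ (x : Ω) t cc,
      0 ≤ (if boxObs S (a - n) (a + w + n) (b - n) (b + h + n) a b w h x t cc ∈ L then (1 : ℝ) else 0) ∧
      (if boxObs S (a - n) (a + w + n) (b - n) (b + h + n) a b w h x t cc ∈ L then (1 : ℝ) else 0) ≤ 1 :=
    fun x t cc => by split_ifs <;> norm_num
  have hoff : ∀ x x' : Ω, ∃ (A : Fin w → Bool) (B : Fin h → Bool), ∀ t cc,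
      (if boxObs S (a - n) (a + w + n) (b - n) (b + h + n) a b w h x' t cc ∈ L then (1 : ℝ) else 0) =
      (if boxObs S (a - n) (a + w + n) (b - n) (b + h + n) a b w h x
        (fun ij => xor (t ij) (xor (A ij.1) (B ij.2))) cc ∈ L then (1 : ℝ) else 0) := by
    intro x x'
    obtain ⟨A, B, hAB⟩ := boxObs_offset S a b w h n x x'
    exact ⟨A, B, fun t cc => by rw [hAB]⟩
  -- the multiplicative offsets of the box statistics, with the explicit factor (hypothesis `h₁`)
  have hoffMul : ∀ (G : (Fin w × Fin h → Bool) → ℝ), (∀ t, 0 ≤ G t) →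
      ∀ (A : Fin w → Bool) (B : Fin h → Bool),
      arrSum (k := h + 2 * n - 1) (pcol S (a - n) (w + 2 * n - 1))
          (fun q => G (fun ij => xor (boxData n w h q ij) (xor (A ij.1) (B ij.2)))) ≤
        ((1 + θIK ^ n) / (1 - θIK ^ n)) ^ (w + h) *
          arrSum (k := h + 2 * n - 1) (pcol S (a - n) (w + 2 * n - 1)) (fun q => G (boxData n w h q)) :=
    fun G hG A B => h₁ n w h hn1 (pcol S (a - n) (w + 2 * n - 1)) θIK hp hθ0 hθlt1 hpθ G hG A B
  -- the factor is admissible: `1 ≤ ((1 + θ^n)/(1 - θ^n))^(w+h)`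
  have hT1 : (1 : ℝ) ≤ ((1 + θIK ^ n) / (1 - θIK ^ n)) ^ (w + h) := by
    refine one_le_pow₀ ?_
    have hx1 : θIK ^ n < 1 := by
      calc θIK ^ n ≤ θIK ^ 1 := pow_le_pow_of_le_one hθ0 hθ1 hn1
        _ = θIK := pow_one _
        _ < 1 := hθlt1
    rw [one_le_div (by linarith)]
    linarith [pow_nonneg hθ0 n]
  have key := h₂ S a b w h n hn1 hσ1 (((1 + θIK ^ n) / (1 - θIK ^ n)) ^ (w + h)) hT1 hoffMul
    (fun x kk => if farObs S (a - n) (a + w + n) (b - n) (b + h + n) (w + 2 * n - 1) (h + 2 * n - 1) x kk ∈ E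
      then (1 : ℝ) else 0)
    (fun x t cc => if boxObs S (a - n) (a + w + n) (b - n) (b + h + n) a b w h x t cc ∈ L then (1 : ℝ) else 0)
    henvm henv01 hbm hb01 hoff
  rw [hpull _ (hE.inter hL), hpull _ hE, hpull _ hL,
    integral_congr_ae (Filter.Eventually.of_forall (indicator_preimage_inter
      (screenShear S (a - n) (a + w + n) (b - n) (b + h + n)) (obs S) E L _ _ hFE hFL)),
    integral_congr_ae (Filter.Eventually.of_forall (indicator_preimage_eq
      (screenShear S (a - n) (a + w + n) (b - n) (b + h + n)) (obs S) E _ hFE)),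
    integral_congr_ae (Filter.Eventually.of_forall (indicator_preimage_eq
      (screenShear S (a - n) (a + w + n) (b - n) (b + h + n)) (obs S) L _ hFL))]
  exact key.trans (mul_le_mul_of_nonneg_right hε' (mul_nonneg (integral_nonneg fun ω => (henv01 _ _).1)
    (integral_nonneg fun ω => (hb01 _ _ _).1)))

end Summit.CriticalPhenomena.CardyFormulaZ2.Theorems.IKLinearTransport.PinnedDiagramExchange

end
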